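import Literature.AnabelianGeometry.SemiGraphs.SemiGraph
import Mathlib.Order.ConditionallyCompleteLattice.Basic
import Mathlib.Order.Lattice.Nat
import Mathlib.Data.Set.Finite.Basic
import Mathlib.Logic.Relation
import HarnessLib

/-!
# Rays through a nested family of connected vertex sets with empty intersection ([SemiAnbd] Thm. 3.7 (iii), p. 41)

Mochizuki, *Semi-graphs of anabelioids*, Publ. RIMS **42** (2006), §3, Theorem 3.7 (iii), author's
manuscript p. 41 ("Since the semi-graphs `𝔾_j` are all finite …") [cite: MochizukiSemiAnbd2006,
Thm. 3.7(iii) p.41]: beyond FINITE semi-graphs the fixed loci of a compact subgroup may ESCAPE along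
the base semi-graph; this file records the purely graph-theoretic fact that such an escape needs an
END of the base semi-graph (an injective consecutively-joined vertex sequence).

PROOF-ONLY, GENERIC file (cell abc-iut, layer L3, GAP row G-t6g3-2b «Thm 3.7 (iii)/Cor 3.9 beyond
finite 𝒢», sub-row **G2·GEN-ENDS (a) / R1a graph half** of L3-lead rulings α38 (3), α48 (3); seat
abc-iut-w5-d189; no definition, nothing specific to anabelioids; consumer: abc-iut-w4-d080's
G2·R1-temp).  For a semi-graph `G` and a family `B n ⊆ Vert G` (`n : ℕ`) which is NESTED
(`Antitone B`), NONEMPTY, CONNECTED in the sense that any two members of `B n` are linked by a chain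
of members of `B n` consecutively joined by edges of `G` (`SemiGraph.Joins`), and has EMPTY
INTERSECTION (every vertex leaves some `B n`):

* `SemiGraph.infinite_of_nested` — every `B n` is infinite (no connectedness needed);
* `SemiGraph.exists_ray_of_eventually_mem` — LAST-VISIT extraction: a vertex sequence `W` which at
  each step stays put or moves along an edge, and which eventually stays inside every `B n`, yields an
  INJECTIVE consecutively-joined vertex sequence eventually inside every `B n` (take the last visits);
* `SemiGraph.exists_ray_of_nested_connected` — the ray: there is an injective sequence of vertices,
  consecutively joined by edges, with a tail inside every `B n` (walk from a point of `B n` to a point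
  of `B (n+1)` inside `B n`, for ever, then extract);
* `SemiGraph.exists_ray_of_nested_connected_directed` — the same for a family indexed by a preorder
  with a monotone cofinal sequence (e.g. the `ℕ`-indexed canonical towers of the cell).

HONEST FRAMING: pure combinatorics; nothing here asserts anything about tempered fundamental groups
or about [IUTchIII] Cor. 3.12.  TEST: for a finite `G` the hypotheses are contradictory
(`infinite_of_nested`), as they must be ("escape needs an infinite `𝔾`"); for the ray semi-graph
`0 – 1 – 2 – ⋯` with `B n = {m | n ≤ m}` the conclusion is the ray itself.
-/

namespace Literature.AnabelianGeometry.SemiGraphs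

namespace SemiGraph

universe v u

variable {G : SemiGraph.{u}}

/-! ### Nested nonempty families with empty intersection are infinite -/

/-- **Every member of a nested nonempty family of vertex sets with empty intersection is infinite**:
if `B n` were finite, each of its vertices leaves the family at some stage, so a common later stage
would be empty. [cite: MochizukiSemiAnbd2006, Thm. 3.7(iii) p.41] -/
theorem infinite_of_nested (B : ℕ → Set G.Vertex) (hanti : Antitone B) (hne : ∀ n, (B n).Nonempty)
    (hempty : ∀ v, ∃ n, v ∉ B n) (n : ℕ) : (B n).Infinite := by
  intro hfin
  classical
  -- a stage after which every vertex of `B n` has left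
  choose N hN using hempty
  obtain ⟨M, hM⟩ : ∃ M, n ≤ M ∧ ∀ v ∈ B n, N v ≤ M := by
    obtain ⟨M₀, hM₀⟩ := (hfin.image N).bddAbove
    refine ⟨max n M₀, le_max_left _ _, fun v hv => (hM₀ ⟨v, hv, rfl⟩).trans (le_max_right _ _)⟩
  obtain ⟨v, hv⟩ := hne M
  have hvn : v ∈ B n := hanti hM.1 hv
  exact hN v (hanti (hM.2 v hvn) hv)

/-! ### Last-visit extraction of a ray from a vertex sequence -/

/-- **Last-visit extraction.**  Let `W : ℕ → Vert G` be a vertex sequence which at each step either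
stays put or moves along an edge (`W (s+1) = W s` or some edge joins `W s` to `W (s+1)`), which
eventually stays inside each `B n`, where every vertex leaves some `B n` (so `W` visits each vertex
only finitely often).  Then there is an INJECTIVE vertex sequence `r`, consecutively joined by edges,
with `r k = W (t k)` for some `t k ≥ k` — hence eventually inside each `B n`.  (Take `t 0` = the last
visit of `W 0`, `t (k+1)` = the last visit of `W (t k + 1)`.)
[cite: MochizukiSemiAnbd2006, Thm. 3.7(iii) p.41] -/
theorem exists_ray_of_eventually_mem (B : ℕ → Set G.Vertex) (hempty : ∀ v, ∃ n, v ∉ B n)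
    (W : ℕ → G.Vertex) (hW : ∀ s, W (s + 1) = W s ∨ ∃ e, G.Joins e (W s) (W (s + 1)))
    (htail : ∀ n, ∃ S, ∀ s, S ≤ s → W s ∈ B n) :
    ∃ r : ℕ → G.Vertex, Function.Injective r ∧ (∀ k, ∃ e, G.Joins e (r k) (r (k + 1))) ∧
      (∀ k, ∃ s, k ≤ s ∧ r k = W s) ∧ ∀ n, ∃ K, ∀ k, K ≤ k → r k ∈ B n := by
  classical
  -- every vertex is visited only finitely often
  have hfin : ∀ a : G.Vertex, {s : ℕ | W s = a}.Finite := by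
    intro a
    obtain ⟨n, hn⟩ := hempty a
    obtain ⟨S, hS⟩ := htail n
    refine (Set.finite_lt_nat S).subset fun s hs => ?_
    by_contra h
    exact hn (hs ▸ hS s (not_lt.mp h))
  have hbdd : ∀ a : G.Vertex, BddAbove {s : ℕ | W s = a} := fun a => (hfin a).bddAbove
  -- the last visit of the vertex seen at time `s`
  let last : ℕ → ℕ := fun s => sSup {s' : ℕ | W s' = W s}
  have hlast_mem : ∀ s, W (last s) = W s := fun s =>
    Nat.sSup_mem (s := {s' : ℕ | W s' = W s}) ⟨s, rfl⟩ (hbdd (W s))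
  have hle_last : ∀ s s', W s' = W s → s' ≤ last s := fun s s' h =>
    le_csSup (hbdd (W s)) h
  have hs_le_last : ∀ s, s ≤ last s := fun s => hle_last s s rfl
  -- the extraction times
  let t : ℕ → ℕ := fun k => Nat.rec (last 0) (fun _ tk => last (tk + 1)) k
  have ht0 : t 0 = last 0 := rfl
  have htS : ∀ k, t (k + 1) = last (t k + 1) := fun k => rfl
  -- `t k` is a last visit: no later time sees the vertex `W (t k)`
  have htlast : ∀ k s', W s' = W (t k) → s' ≤ t k := by
    intro k s' h
    cases k with
    | zero =>
      rw [ht0] at h ⊢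
      exact hle_last 0 s' (h.trans (hlast_mem 0))
    | succ k =>
      rw [htS] at h ⊢
      exact hle_last _ s' (h.trans (hlast_mem _))
  have hWt : ∀ k, W (t (k + 1)) = W (t k + 1) := fun k => by rw [htS]; exact hlast_mem _
  have htlt : ∀ k, t k < t (k + 1) := fun k => by
    rw [htS]; exact Nat.lt_of_lt_of_le (Nat.lt_succ_self _) (hs_le_last _)
  have htmono : StrictMono t := strictMono_nat_of_lt_succ htlt
  have hkt : ∀ k, k ≤ t k := fun k => htmono.id_le k
  refine ⟨fun k => W (t k), fun k k' h => ?_, fun k => ?_, fun k => ⟨t k, hkt k, rfl⟩, fun n => ?_⟩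
  · -- injective: a repeated vertex would be visited after its last visit
    by_contra hne
    rcases Nat.lt_or_gt_of_ne hne with hlt | hlt
    · exact absurd (htlast k (t k') h.symm) (not_le.mpr (htmono hlt))
    · exact absurd (htlast k' (t k) h) (not_le.mpr (htmono hlt))
  · -- consecutive: `r (k+1) = W (t k + 1)` and `W` does not stay put at a last visit
    show ∃ e, G.Joins e (W (t k)) (W (t (k + 1)))
    rw [hWt k]
    rcases hW (t k) with h | h
    · exact absurd (htlast k (t k + 1) h) (by omega)
    · exact h
  · obtain ⟨S, hS⟩ := htail n
    exact ⟨S, fun k hk => hS (t k) (hk.trans (hkt k))⟩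

/-! ### Finite walks inside a vertex set, as sequences -/

/-- Joined-within-`S` reachability gives a finite walk inside `S`, recorded as a sequence
`q 0 = x, q 1, …, q m = y` of members of `S` consecutively joined by edges.
[cite: MochizukiSemiAnbd2006, Thm. 3.7(iii) p.41] -/
theorem exists_walkSeq_of_reflTransGen (S : Set G.Vertex) {x y : G.Vertex} (hx : x ∈ S)
    (h : Relation.ReflTransGen (fun a b => b ∈ S ∧ ∃ e, G.Joins e a b) x y) :
    ∃ (q : ℕ → G.Vertex) (m : ℕ), q 0 = x ∧ q m = y ∧ (∀ j, j ≤ m → q j ∈ S) ∧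
      ∀ j, j < m → ∃ e, G.Joins e (q j) (q (j + 1)) := by
  induction h with
  | refl => exact ⟨fun _ => x, 0, rfl, rfl, fun _ _ => hx, fun j hj => absurd hj (Nat.not_lt_zero _)⟩
  | @tail b c _ hbc ih =>
    obtain ⟨q, m, hq0, hqm, hqS, hqR⟩ := ih
    obtain ⟨hcS, e, he⟩ := hbc
    refine ⟨fun j => if j ≤ m then q j else c, m + 1, by simp [hq0], by simp, fun j hj => ?_,
      fun j hj => ?_⟩
    · by_cases hjm : j ≤ m
      · simp only [hjm, if_true]; exact hqS j hjm
      · simp only [hjm, if_false]; exact hcS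
    · rcases Nat.lt_succ_iff_lt_or_eq.mp hj with hlt | rfl
      · have h1 : j ≤ m := hlt.le
        have h2 : j + 1 ≤ m := hlt
        simp only [h1, h2, if_true]
        exact hqR j hlt
      · simp only [le_refl, if_true, Nat.not_succ_le_self, if_false, hqm]
        exact ⟨e, he⟩

/-! ### The ray through a nested connected family -/

/-- **A nested family of connected vertex sets with empty intersection is escaped along a ray.**  Let
`B n ⊆ Vert G` (`n : ℕ`) be nested (`Antitone B`), nonempty, each CONNECTED by chains of its own
members consecutively joined by edges of `G`, with empty intersection.  Then there is an injective
sequence of vertices of `G`, consecutively joined by edges, with a tail inside every `B n` (so every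
`B n` is infinite and `G` has an end into which the `B n` escape).  Construction: walk inside `B n`
from a point of `B (n+1)` to a point of `B (n+2)`, for `n = 0, 1, 2, …` (an infinite vertex sequence
eventually inside each `B n`), then extract the last visits (`exists_ray_of_eventually_mem`).
[cite: MochizukiSemiAnbd2006, Thm. 3.7(iii) p.41] -/
theorem exists_ray_of_nested_connected (B : ℕ → Set G.Vertex) (hanti : Antitone B)
    (hne : ∀ n, (B n).Nonempty)
    (hconn : ∀ n, ∀ x ∈ B n, ∀ y ∈ B n,
      Relation.ReflTransGen (fun a b => b ∈ B n ∧ ∃ e, G.Joins e a b) x y)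
    (hempty : ∀ v, ∃ n, v ∉ B n) :
    ∃ r : ℕ → G.Vertex, Function.Injective r ∧ (∀ k, ∃ e, G.Joins e (r k) (r (k + 1))) ∧
      ∀ n, ∃ K, ∀ k, K ≤ k → r k ∈ B n := by
  classical
  -- a `good` block at level `n` from `x`: a walk `q 0 = x, …, q m` inside `B n` ending in `B (n+1)`
  let good : ℕ → G.Vertex → (ℕ → G.Vertex) × ℕ → Prop := fun n x qm =>
    qm.1 0 = x ∧ (∀ j, j ≤ qm.2 → qm.1 j ∈ B n) ∧
      (∀ j, j < qm.2 → ∃ e, G.Joins e (qm.1 j) (qm.1 (j + 1))) ∧ qm.1 qm.2 ∈ B (n + 1)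
  have hgood : ∀ n x, x ∈ B (n + 1) → ∃ qm : (ℕ → G.Vertex) × ℕ, good (n + 1) x qm := by
    intro n x hx
    obtain ⟨y, hy⟩ := hne (n + 2)
    obtain ⟨q, m, hq0, hqm, hqS, hqR⟩ :=
      exists_walkSeq_of_reflTransGen (B (n + 1)) hx (hconn (n + 1) x hx y (hanti (Nat.le_succ _) hy))
    exact ⟨(q, m), hq0, hqS, hqR, by show q m ∈ B (n + 1 + 1); rw [hqm]; exact hy⟩
  -- states `(n, p, i, m)`: level, current block, position, block length
  let St := ℕ × (ℕ → G.Vertex) × ℕ × ℕ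
  let step : St → St := fun σ =>
    if σ.2.2.1 < σ.2.2.2 then (σ.1, σ.2.1, σ.2.2.1 + 1, σ.2.2.2)
    else if h : ∃ qm : (ℕ → G.Vertex) × ℕ, good (σ.1 + 1) (σ.2.1 σ.2.2.1) qm
      then (σ.1 + 1, h.choose.1, 0, h.choose.2)
      else σ
  obtain ⟨x₀, hx₀⟩ := hne 1
  let σ₀ : St := (0, fun _ => x₀, 0, 0)
  let st : ℕ → St := fun s => step^[s] σ₀
  have hst : ∀ s, st (s + 1) = step (st s) := fun s => Function.iterate_succ_apply' step s σ₀
  -- the invariant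
  let I : St → Prop := fun σ => σ.2.2.1 ≤ σ.2.2.2 ∧ (∀ j, j ≤ σ.2.2.2 → σ.2.1 j ∈ B σ.1) ∧
    (∀ j, j < σ.2.2.2 → ∃ e, G.Joins e (σ.2.1 j) (σ.2.1 (j + 1))) ∧ σ.2.1 σ.2.2.2 ∈ B (σ.1 + 1)
  have hI0 : I σ₀ :=
    ⟨le_rfl, fun _ _ => hanti (Nat.zero_le 1) hx₀, fun j hj => absurd hj (Nat.not_lt_zero _), hx₀⟩
  -- the two kinds of steps
  have hstep_lt : ∀ σ : St, σ.2.2.1 < σ.2.2.2 → step σ = (σ.1, σ.2.1, σ.2.2.1 + 1, σ.2.2.2) := by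
    intro σ h
    simp only [step, h, if_true]
  have hstep_eq : ∀ σ : St, I σ → ¬ σ.2.2.1 < σ.2.2.2 →
      ∃ qm : (ℕ → G.Vertex) × ℕ, good (σ.1 + 1) (σ.2.1 σ.2.2.1) qm ∧
        step σ = (σ.1 + 1, qm.1, 0, qm.2) := by
    intro σ hIσ h
    have him : σ.2.2.1 = σ.2.2.2 := le_antisymm hIσ.1 (not_lt.mp h)
    have hex : ∃ qm : (ℕ → G.Vertex) × ℕ, good (σ.1 + 1) (σ.2.1 σ.2.2.1) qm :=
      hgood σ.1 _ (him ▸ hIσ.2.2.2)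
    refine ⟨hex.choose, hex.choose_spec, ?_⟩
    simp only [step, h, if_false, hex, dif_pos]
  have hI : ∀ s, I (st s) := by
    intro s
    induction s with
    | zero => exact hI0
    | succ s ih =>
      rw [hst]
      by_cases h : (st s).2.2.1 < (st s).2.2.2
      · rw [hstep_lt _ h]
        exact ⟨h, ih.2.1, ih.2.2.1, ih.2.2.2⟩
      · obtain ⟨qm, hqm, hσ⟩ := hstep_eq _ ih h
        rw [hσ]
        exact ⟨Nat.zero_le _, hqm.2.1, hqm.2.2.1, hqm.2.2.2⟩
  -- the vertex sequence and its levels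
  let W : ℕ → G.Vertex := fun s => (st s).2.1 (st s).2.2.1
  let lev : ℕ → ℕ := fun s => (st s).1
  have hWmem : ∀ s, W s ∈ B (lev s) := fun s => (hI s).2.1 _ (hI s).1
  have hW : ∀ s, W (s + 1) = W s ∨ ∃ e, G.Joins e (W s) (W (s + 1)) := by
    intro s
    show (st (s + 1)).2.1 (st (s + 1)).2.2.1 = (st s).2.1 (st s).2.2.1 ∨
      ∃ e, G.Joins e ((st s).2.1 (st s).2.2.1) ((st (s + 1)).2.1 (st (s + 1)).2.2.1)
    rw [hst]
    by_cases h : (st s).2.2.1 < (st s).2.2.2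
    · right
      rw [hstep_lt _ h]
      exact (hI s).2.2.1 _ h
    · left
      obtain ⟨qm, hqm, hσ⟩ := hstep_eq _ (hI s) h
      rw [hσ]
      exact hqm.1
  have hlev_succ : ∀ s, lev (s + 1) = lev s ∨ lev (s + 1) = lev s + 1 := by
    intro s
    show (st (s + 1)).1 = (st s).1 ∨ (st (s + 1)).1 = (st s).1 + 1
    rw [hst]
    by_cases h : (st s).2.2.1 < (st s).2.2.2
    · left; rw [hstep_lt _ h]
    · right
      obtain ⟨qm, -, hσ⟩ := hstep_eq _ (hI s) h
      rw [hσ]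
  have hlev_mono : Monotone lev := by
    refine monotone_nat_of_le_succ fun s => ?_
    rcases hlev_succ s with h | h <;> omega
  -- each block is finished after finitely many steps, and then the level goes up
  have hlev_up : ∀ d s, (st s).2.2.2 - (st s).2.2.1 = d → lev (s + d + 1) = lev s + 1 := by
    intro d
    induction d with
    | zero =>
      intro s hd
      have h : ¬ (st s).2.2.1 < (st s).2.2.2 := by omega
      obtain ⟨qm, -, hσ⟩ := hstep_eq _ (hI s) h
      show (st (s + 0 + 1)).1 = (st s).1 + 1
      rw [Nat.add_zero, hst, hσ]
    | succ d ih =>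
      intro s hd
      have h : (st s).2.2.1 < (st s).2.2.2 := by omega
      have h1 : st (s + 1) = ((st s).1, (st s).2.1, (st s).2.2.1 + 1, (st s).2.2.2) := by
        rw [hst, hstep_lt _ h]
      have hd' : (st (s + 1)).2.2.2 - (st (s + 1)).2.2.1 = d := by rw [h1]; dsimp only; omega
      have hl : lev (s + 1) = lev s := by show (st (s + 1)).1 = (st s).1; rw [h1]
      have := ih (s + 1) hd'
      rw [hl] at this
      rw [← this]
      congr 1
      omega
  have hlev_unbdd : ∀ N, ∃ S, N ≤ lev S := by
    intro N
    induction N with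
    | zero => exact ⟨0, Nat.zero_le _⟩
    | succ N ih =>
      obtain ⟨S, hS⟩ := ih
      refine ⟨S + ((st S).2.2.2 - (st S).2.2.1) + 1, ?_⟩
      rw [hlev_up _ S rfl]
      omega
  have htail : ∀ n, ∃ S, ∀ s, S ≤ s → W s ∈ B n := by
    intro n
    obtain ⟨S, hS⟩ := hlev_unbdd n
    exact ⟨S, fun s hs => hanti (hS.trans (hlev_mono hs)) (hWmem s)⟩
  obtain ⟨r, hrinj, hrjoin, -, hrtail⟩ := exists_ray_of_eventually_mem B hempty W hW htail
  exact ⟨r, hrinj, hrjoin, hrtail⟩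

/-- **Directed-index form.**  For a family `B j ⊆ Vert G` indexed by a preorder, antitone, nonempty,
connected by joined chains of its own members, with empty intersection, and admitting a MONOTONE
COFINAL sequence of indices (e.g. any `ℕ`-indexed tower), there is an injective consecutively-joined
vertex sequence with a tail inside every `B j`. [cite: MochizukiSemiAnbd2006, Thm. 3.7(iii) p.41] -/
theorem exists_ray_of_nested_connected_directed {J : Type v} [Preorder J] (B : J → Set G.Vertex)
    (hanti : ∀ ⦃i j : J⦄, i ≤ j → B j ⊆ B i) (hne : ∀ j, (B j).Nonempty)
    (hconn : ∀ j, ∀ x ∈ B j, ∀ y ∈ B j,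
      Relation.ReflTransGen (fun a b => b ∈ B j ∧ ∃ e, G.Joins e a b) x y)
    (hempty : ∀ v, ∃ j, v ∉ B j) (s : ℕ → J) (hs : Monotone s) (hcof : ∀ j, ∃ n, j ≤ s n) :
    ∃ r : ℕ → G.Vertex, Function.Injective r ∧ (∀ k, ∃ e, G.Joins e (r k) (r (k + 1))) ∧
      ∀ j, ∃ K, ∀ k, K ≤ k → r k ∈ B j := by
  obtain ⟨r, hrinj, hrjoin, hrtail⟩ := exists_ray_of_nested_connected (fun n => B (s n))
    (fun m n h => hanti (hs h)) (fun n => hne (s n)) (fun n => hconn (s n))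
    (fun v => by
      obtain ⟨j, hj⟩ := hempty v
      obtain ⟨n, hn⟩ := hcof j
      exact ⟨n, fun h => hj (hanti hn h)⟩)
  refine ⟨r, hrinj, hrjoin, fun j => ?_⟩
  obtain ⟨n, hn⟩ := hcof j
  obtain ⟨K, hK⟩ := hrtail n
  exact ⟨K, fun k hk => hanti hn (hK k hk)⟩

/-- **Infinite members, directed-index form**: with a monotone cofinal sequence of indices, every
`B j` of an antitone nonempty family with empty intersection is infinite.
[cite: MochizukiSemiAnbd2006, Thm. 3.7(iii) p.41] -/
theorem infinite_of_nested_directed {J : Type v} [Preorder J] (B : J → Set G.Vertex)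
    (hanti : ∀ ⦃i j : J⦄, i ≤ j → B j ⊆ B i) (hne : ∀ j, (B j).Nonempty)
    (hempty : ∀ v, ∃ j, v ∉ B j) (s : ℕ → J) (hs : Monotone s) (hcof : ∀ j, ∃ n, j ≤ s n)
    (j : J) : (B j).Infinite := by
  obtain ⟨n, hn⟩ := hcof j
  have h := infinite_of_nested (fun n => B (s n)) (fun m n h => hanti (hs h)) (fun n => hne (s n))
    (fun v => by
      obtain ⟨j, hj⟩ := hempty v
      obtain ⟨n, hn⟩ := hcof j
      exact ⟨n, fun h => hj (hanti hn h)⟩) n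
  exact h.mono (hanti hn)

end SemiGraph

end Literature.AnabelianGeometry.SemiGraphs
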